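import Literature.NumberTheory.LFunctions.DedekindZetaRealZerosUniform
import Literature.NumberTheory.LFunctions.StarkNoQuadraticSubfieldGlue
import HarnessLib

/-!
# Crux `LinnikCubicClassGroups.DegreeOnePrimesEscape` (stmt-QuantumAdvantage-11543) — stub `stub_collisionTransfer`

Line `dedekind-s3-collision`, stub `stub_collisionTransfer` (the collision proper): Dedekind's
relation `ζ_N · ζ² = ζ_k · ζ_K²` for `S₃`-sextics (hypothesis 1, Dirichlet series on `Re s > 1`)
and the embedded `S₃`-closure with a polynomial discriminant bound `|d_N| ≤ |d_K|^A`
(hypothesis 2) give a real-zero-free interval `[1 − c/log|d_K|, 1)` for `ζ_K`, uniformly over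
the NON-Galois cubic number fields `K`.

Proof: suppose `ζ_K(σ) = 0` with `1 − c/log|d_K| ≤ σ < 1`; `|d_K| ≥ 3` so `σ > 1/2`. Move the
zero to the copy `K' ≅ K` inside `N` (`dedekindZetaCont_eq_of_algEquiv`). Both sides of the
relation, read on the continuations, are analytic on `{1}ᶜ` and agree on `Re s > 1`, hence on
`{1}ᶜ` (identity theorem, `{1}ᶜ ⊆ ℂ` is connected). Analytic orders at `σ` add:
`ord ζ_N + 2·ord ζ = ord ζ_k + 2·ord ζ_{K'}` with `ord ζ = 0` (`ζ(σ) < 0` on `(0,1)`) and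
`ord ζ_{K'} ≥ 1`, so `ord_σ ζ₁_N = ord_σ ζ_N ≥ 2`, and the tree's uniform simplicity theorem
`exists_realZero_simple_dedekindZeta₁ 6` gives `σ ≤ 1 − c₆/(log|d_N| + log 4)`; finally
`log|d_N| + log 4 ≤ (A + 2)·log|d_K|`, contradiction for `c = min(1/2, c₆/(2(A+2)))`.
-/

noncomputable section

open scoped NumberField nonZeroDivisors
open Literature.NumberTheory.LFunctions Literature.NumberTheory.LFunctions.NumberField
open Complex Filter Topology Set

namespace Summit.QuantumAdvantage.QuantumAdvantage.Theorems.DegreeOnePrimesEscape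

/-- **Continuation of a Dirichlet-series identity off `s = 1`**: if
`ζ_N(s)·ζ(s)² = ζ_k(s)·ζ_{K'}(s)²` holds for the Dirichlet series on `Re s > 1`, it holds for
the continued Dedekind zeta functions on `{1}ᶜ` (identity theorem). -/
theorem collisionTransfer_eqOn (N k K' : Type) [Field N] [NumberField N] [Field k] [NumberField k]
    [Field K'] [NumberField K']
    (hrel : ∀ s : ℂ, 1 < s.re →
      NumberField.dedekindZeta N s * riemannZeta s ^ 2 =
        NumberField.dedekindZeta k s * NumberField.dedekindZeta K' s ^ 2) :
    EqOn (dedekindZetaCont N * riemannZeta ^ 2) (dedekindZetaCont k * dedekindZetaCont K' ^ 2)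
      {1}ᶜ := by
  have hpc : IsPreconnected ({1}ᶜ : Set ℂ) :=
    (isConnected_compl_singleton_of_one_lt_rank (rank_real_complex ▸ Nat.one_lt_ofNat) _)
      |>.isPreconnected
  have hne : (2 : ℂ) ∈ ({1}ᶜ : Set ℂ) := by simp
  have hN : DifferentiableOn ℂ (dedekindZetaCont N) {1}ᶜ := differentiableOn_dedekindZetaCont_holds N
  have hk : DifferentiableOn ℂ (dedekindZetaCont k) {1}ᶜ := differentiableOn_dedekindZetaCont_holds k
  have hK' : DifferentiableOn ℂ (dedekindZetaCont K') {1}ᶜ :=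
    differentiableOn_dedekindZetaCont_holds K'
  have hF : DifferentiableOn ℂ (dedekindZetaCont N * riemannZeta ^ 2) {1}ᶜ :=
    hN.mul (differentiableOn_riemannZeta.pow 2)
  have hG : DifferentiableOn ℂ (dedekindZetaCont k * dedekindZetaCont K' ^ 2) {1}ᶜ :=
    hk.mul (hK'.pow 2)
  refine AnalyticOnNhd.eqOn_of_preconnected_of_eventuallyEq (𝕜 := ℂ)
    (hF.analyticOnNhd isOpen_compl_singleton) (hG.analyticOnNhd isOpen_compl_singleton) hpc hne ?_
  refine eventually_of_mem ?_ (fun t (ht : 1 < t.re) ↦ ?_)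
  · exact (continuous_re.isOpen_preimage _ isOpen_Ioi).mem_nhds (by simp : 1 < (2 : ℂ).re)
  · simp only [Pi.mul_apply, Pi.pow_apply]
    rw [dedekindZetaCont_eq_dedekindZeta_holds ht, dedekindZetaCont_eq_dedekindZeta_holds ht,
      dedekindZetaCont_eq_dedekindZeta_holds ht]
    exact hrel t ht

/-- **Orders at a common real point**: if `ζ_N·ζ² = ζ_k·ζ_{K'}²` on `{1}ᶜ`, `ζ_{K'}(σ) = 0` and
`ζ(σ) ≠ 0` at some `σ ≠ 1`, then `ord_σ ζ₁_N ≥ 2`. -/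
theorem collisionTransfer_two_le_order (N k K' : Type) [Field N] [NumberField N] [Field k]
    [NumberField k] [Field K'] [NumberField K']
    (heq : EqOn (dedekindZetaCont N * riemannZeta ^ 2) (dedekindZetaCont k * dedekindZetaCont K' ^ 2)
      {1}ᶜ)
    {s : ℂ} (hs : s ≠ 1) (hζ : riemannZeta s ≠ 0) (hz : dedekindZetaCont K' s = 0) :
    (2 : ℕ∞) ≤ analyticOrderAt (dedekindZeta₁ N) s := by
  have hN : AnalyticAt ℂ (dedekindZetaCont N) s := analyticAt_dedekindZetaCont hs
  have hk : AnalyticAt ℂ (dedekindZetaCont k) s := analyticAt_dedekindZetaCont hs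
  have hK' : AnalyticAt ℂ (dedekindZetaCont K') s := analyticAt_dedekindZetaCont hs
  have hζa : AnalyticAt ℂ riemannZeta s :=
    differentiableOn_riemannZeta.analyticAt (isOpen_compl_singleton.mem_nhds hs)
  have hev : (dedekindZetaCont N * riemannZeta ^ 2) =ᶠ[𝓝 s]
      (dedekindZetaCont k * dedekindZetaCont K' ^ 2) := by
    filter_upwards [isOpen_compl_singleton.mem_nhds hs] with z hz
    exact heq hz
  have hordF : analyticOrderAt (dedekindZetaCont N * riemannZeta ^ 2) s =
      analyticOrderAt (dedekindZetaCont N) s := by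
    rw [analyticOrderAt_mul hN (hζa.pow 2), analyticOrderAt_pow hζa,
      hζa.analyticOrderAt_eq_zero.mpr hζ, nsmul_zero, add_zero]
  have hordG : (2 : ℕ∞) ≤ analyticOrderAt (dedekindZetaCont k * dedekindZetaCont K' ^ 2) s := by
    rw [analyticOrderAt_mul hk (hK'.pow 2), analyticOrderAt_pow hK']
    have h1 : (1 : ℕ∞) ≤ analyticOrderAt (dedekindZetaCont K') s :=
      Order.one_le_iff_ne_zero.mpr (hK'.analyticOrderAt_ne_zero.mpr hz)
    calc (2 : ℕ∞) = 2 • (1 : ℕ∞) := by norm_num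
      _ ≤ 2 • analyticOrderAt (dedekindZetaCont K') s := nsmul_le_nsmul_right h1 2
      _ ≤ analyticOrderAt (dedekindZetaCont k) s + 2 • analyticOrderAt (dedekindZetaCont K') s :=
        le_add_self
  rw [analyticOrderAt_dedekindZeta₁_eq_dedekindZetaCont hs, ← hordF, analyticOrderAt_congr hev]
  exact hordG

/-- **Inequality glue**: with `3 ≤ d_K`, `1 ≤ d_N ≤ d_K^A`, `0 < c₆`, the bound
`σ ≤ 1 − c₆/(log d_N + log 4)` contradicts `1 − (c₆/(2(A+2)))/log d_K ≤ σ`. -/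
theorem collisionTransfer_ineq {dK dN A : ℕ} {c₆ σ : ℝ} (hc₆ : 0 < c₆) (hdK : 3 ≤ dK)
    (hdN : 1 ≤ dN) (hle : dN ≤ dK ^ A)
    (hσ : 1 - c₆ / (2 * ((A : ℝ) + 2)) / Real.log dK ≤ σ)
    (hβ : σ ≤ 1 - c₆ / (Real.log dN + Real.log 4)) : False := by
  have hdK' : (3 : ℝ) ≤ dK := by exact_mod_cast hdK
  have hdN' : (1 : ℝ) ≤ dN := by exact_mod_cast hdN
  have hlogK : 1 < Real.log dK := by
    rw [← Real.log_exp 1]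
    refine Real.log_lt_log (Real.exp_pos 1) (lt_of_lt_of_le ?_ hdK')
    have := Real.exp_one_lt_d9
    linarith
  have hlogN : 0 ≤ Real.log dN := Real.log_nonneg hdN'
  have h1 : Real.log dN ≤ A * Real.log dK := by
    calc Real.log dN ≤ Real.log ((dK : ℝ) ^ A) :=
          Real.log_le_log (by positivity) (by exact_mod_cast hle)
      _ = A * Real.log dK := Real.log_pow (dK : ℝ) A
  have h4 : Real.log 4 ≤ 2 * Real.log dK := by
    have h := Real.log_le_log (by norm_num : (0 : ℝ) < 4) (show (4 : ℝ) ≤ (dK : ℝ) ^ 2 by nlinarith)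
    rwa [Real.log_pow, Nat.cast_ofNat] at h
  have h4pos : 0 < Real.log 4 := Real.log_pos (by norm_num)
  have hsum : Real.log dN + Real.log 4 ≤ ((A : ℝ) + 2) * Real.log dK := by nlinarith
  have hsum_pos : 0 < Real.log dN + Real.log 4 := by linarith
  have hA2 : (0 : ℝ) < (A : ℝ) + 2 := by positivity
  set X : ℝ := c₆ / (((A : ℝ) + 2) * Real.log dK) with hX
  have hXpos : 0 < X := div_pos hc₆ (mul_pos hA2 (by linarith))
  have hXle : X ≤ c₆ / (Real.log dN + Real.log 4) :=
    div_le_div_of_nonneg_left hc₆.le hsum_pos hsum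
  have hX2 : c₆ / (2 * ((A : ℝ) + 2)) / Real.log dK = X / 2 := by
    rw [hX]
    field_simp
  rw [hX2] at hσ
  linarith

/-- **STUB `stub_collisionTransfer`** (line `dedekind-s3-collision`, D3+D5 — the collision transfer):
Dedekind's relation `ζ_N·ζ² = ζ_k·ζ_K²` for Galois sextics with non-abelian group (hypothesis 1)
and the embedded `S₃`-closure with `|d_N| ≤ |d_K|^A` (hypothesis 2) imply a real-zero-free interval
`[1 − c/log|d_K|, 1)` for the continued Dedekind zeta function of every non-Galois cubic field. -/
theorem stub_collisionTransfer :
    (∀ (N : Type) [Field N] [NumberField N] [IsGalois ℚ N], Module.finrank ℚ N = 6 →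
      (∃ g h : N ≃ₐ[ℚ] N, g * h ≠ h * g) →
      ∀ (K k : IntermediateField ℚ N), Module.finrank ℚ K = 3 → Module.finrank ℚ k = 2 →
      ∀ s : ℂ, 1 < s.re →
        NumberField.dedekindZeta N s * riemannZeta s ^ 2 =
          NumberField.dedekindZeta k s * NumberField.dedekindZeta K s ^ 2) →
    (∃ A : ℕ, ∀ (K : Type) [Field K] [NumberField K], Module.finrank ℚ K = 3 → ¬ IsGalois ℚ K →
      ∃ (N : Type) (_ : Field N) (_ : NumberField N), IsGalois ℚ N ∧ Module.finrank ℚ N = 6 ∧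
        (∃ g h : N ≃ₐ[ℚ] N, g * h ≠ h * g) ∧
        (∃ K' : IntermediateField ℚ N, Nonempty (K ≃ₐ[ℚ] K')) ∧
        (∃ k : IntermediateField ℚ N, Module.finrank ℚ k = 2) ∧
        (NumberField.discr N).natAbs ≤ (NumberField.discr K).natAbs ^ A) →
    ∃ c : ℝ, 0 < c ∧ ∀ (K : Type) [Field K] [NumberField K], Module.finrank ℚ K = 3 → ¬ IsGalois ℚ K →
      ∀ σ : ℝ, 1 - c / Real.log ((NumberField.discr K).natAbs : ℝ) ≤ σ → σ < 1 →
        dedekindZetaCont K σ ≠ 0 := by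
  intro hrel hclos
  obtain ⟨A, hA⟩ := hclos
  obtain ⟨c₆, hc₆, h₆⟩ := exists_realZero_simple_dedekindZeta₁ 6
  have hA2 : (0 : ℝ) < 2 * ((A : ℝ) + 2) := by positivity
  refine ⟨min (1 / 2) (c₆ / (2 * ((A : ℝ) + 2))), lt_min (by norm_num) (div_pos hc₆ hA2), ?_⟩
  intro K _ _ hK hnG σ hσ hσ1 hz
  -- discriminant of `K`
  have hdK3 : 3 ≤ (NumberField.discr K).natAbs := by
    have h := NumberField.abs_discr_gt_two (K := K) (by rw [hK]; norm_num)
    rw [Int.abs_eq_natAbs] at h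
    omega
  have hdK' : (3 : ℝ) ≤ ((NumberField.discr K).natAbs : ℝ) := by exact_mod_cast hdK3
  have hlogK : 1 < Real.log ((NumberField.discr K).natAbs : ℝ) := by
    rw [← Real.log_exp 1]
    refine Real.log_lt_log (Real.exp_pos 1) (lt_of_lt_of_le ?_ hdK')
    have := Real.exp_one_lt_d9
    linarith
  -- `σ > 0`, `σ ≠ 1`
  have hcle : min (1 / 2) (c₆ / (2 * ((A : ℝ) + 2))) / Real.log ((NumberField.discr K).natAbs : ℝ)
      ≤ 1 / 2 := by
    calc _ ≤ min (1 / 2) (c₆ / (2 * ((A : ℝ) + 2))) :=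
          div_le_self (lt_min (by norm_num) (div_pos hc₆ hA2)).le hlogK.le
      _ ≤ 1 / 2 := min_le_left _ _
  have hσ0 : 0 < σ := by linarith
  have hs1 : (σ : ℂ) ≠ 1 := by
    intro h
    have : σ = 1 := by exact_mod_cast h
    exact absurd this hσ1.ne
  -- the closure
  obtain ⟨N, _, _, hGal, hN6, hnonab, ⟨K', ⟨e⟩⟩, ⟨k, hk⟩, hdisc⟩ := hA K hK hnG
  have hK' : Module.finrank ℚ K' = 3 := by rw [← e.toLinearEquiv.finrank_eq]; exact hK
  -- transport the zero to `K'`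
  have hzK' : dedekindZetaCont K' σ = 0 := by
    rw [← dedekindZetaCont_eq_of_algEquiv e hs1]; exact hz
  -- continue the relation and add orders
  have heq := collisionTransfer_eqOn N k K' (fun s hs => hrel N hN6 hnonab K' k hK' hk s hs)
  have hζ : riemannZeta σ ≠ 0 := riemannZeta_ofReal_ne_zero_of_pos_of_lt_one σ hσ0 hσ1
  have hord := collisionTransfer_two_le_order N k K' heq hs1 hζ hzK'
  -- the uniform simplicity theorem in degree `6`
  have hβ := h₆ N hN6 σ hord
  -- inequalities
  have hdN1 : 1 ≤ (NumberField.discr N).natAbs :=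
    Nat.one_le_iff_ne_zero.mpr (Int.natAbs_ne_zero.mpr (NumberField.discr_ne_zero N))
  have hσ' : 1 - c₆ / (2 * ((A : ℝ) + 2)) / Real.log ((NumberField.discr K).natAbs : ℝ) ≤ σ := by
    refine le_trans ?_ hσ
    have : min (1 / 2) (c₆ / (2 * ((A : ℝ) + 2))) / Real.log ((NumberField.discr K).natAbs : ℝ) ≤
        c₆ / (2 * ((A : ℝ) + 2)) / Real.log ((NumberField.discr K).natAbs : ℝ) :=
      div_le_div_of_nonneg_right (min_le_right _ _) (by linarith)
    linarith
  exact collisionTransfer_ineq hc₆ hdK3 hdN1 hdisc hσ' hβ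

end Summit.QuantumAdvantage.QuantumAdvantage.Theorems.DegreeOnePrimesEscape

end
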